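import Summits.BirchSwinnertonDyer.BirchSwinnertonDyer.Theorems.Rank1ResidualJetConjActPlaceUnramified
import Summits.BirchSwinnertonDyer.BirchSwinnertonDyer.Theorems.Rank1ResidualJetLiftBalanced
import Summits.BirchSwinnertonDyer.BirchSwinnertonDyer.Theorems.Rank1ResidualJetKolyvaginLocalTermKummer
import Summits.BirchSwinnertonDyer.BirchSwinnertonDyer.Theorems.Rank1ResidualJetWeilDatumConj
import Summits.BirchSwinnertonDyer.Rank1Residual.X11b.KummerRelaxedStructures
import Literature.NumberTheory.EllipticCurves.PoitouTateSelmerStructuresConj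
import HarnessLib

/-!
# T1 JET (cell `bsd-jet`), road K, input (L1) PROVED: the Kolyvagin-prime local term
# `hloc : (Kum_λ).relIndex (ker(σ_{*,λ} − s)) = p^k` of the H63 line

HONEST FRAMING (programme file `BSD-LIT2PART-PROGRAMME-v1.md` §HONESTY, verbatim): «no tranche here
proves BSD; ARM L moves the LITERAL column of an r ≤ 1 census into the kernel-proved-modulo-named-print
column; ARM P changes what «named print» is worth.» THEOREMS ONLY (seat `bsd-jet-pv-1`, session g6;
`--supports stmt-BirchSwinnertonDyer-14418`, helper): no definition, no named fact, no `sorry`.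
Nothing is booked; 0 classes move.

## What

`K` imaginary quadratic with complex conjugation `τ` (`τ ≠ 1`, `τ² = 1`), `E = W/ℚ` in global
minimal form, `p` an odd prime, `1 ≤ k ≤ M(ℓ)` for a Kolyvagin prime `ℓ` of W. Zhang, `v = λ ∋ ℓ`
(so `τ • v = v`), `s = ±1`.
* `exists_transport_liftAutPlace_mem_decompositionSubgroup` — the ADAPTED LIFT
  `τ̃ = liftAutPlace τ hfix` of `conjActPlace` is `e γ e⁻¹` for a `γ ∈ Γ_ℚ` stabilising
  `𝔓₀ ∩ \bar ℤ`, `𝔓₀ = adicCompletionPrime K λ` the prime cut out by `K̄ → \bar K_λ`: the lift `Θ`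
  of the Galois transport of `K_λ` to `\bar K_λ` preserves the maximal ideal of the absolute integers
  (brick E₂ `map_mem_absIntegers_of_isLiftOfRingEquiv` + [AbsAnab] `map_mem_absMaximalIdeal`), which
  is the spectral open unit ball (`mem_radical_map_maximalIdeal_iff`);
* **`natCard_kummer_inf_ker_conjActPlace_eq_pow`** — UNCONDITIONAL:
  `#(Kum_λ ∩ ker(σ_{*,λ} − s)) = p^k` on `H¹(K_λ, E[p^k])`: `Kum_λ = H¹_ur` (x11b3
  `kummerSelmerStructure_inr_eq_unramifiedSubgroup`), brick E₂ (count on `E[p^k]` through `τ̃_*`),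
  brick D (`τ̃_*` is balanced);
* **`relIndex_kummer_ker_conjActPlace_eq_pow`** — the binder `hloc` of
  `JET.tamagawaExponent_le_mInfty_of_localInputs` (pv-2, p508802) VERBATIM, for every Zhang–Kolyvagin
  `ℓ` with `k ≤ M(ℓ)`, every place `v ∋ ℓ`, every `hfix`, `s = ±1` — GIVEN the named fact
  `poitouTate_selmerStructure_duality_conj K` (already a hypothesis `hPT` of that theorem; it supplies
  the perfect, conjugation-compatible local Tate pairing through which session g5's
  `relIndex_kummer_ker_eq_natCard_kummer_inf` turns the relative index into the count above; the Weil
  datum is the proved `exists_weilPairing_liftEquivariant`).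
This is Jetchev 2008 §3.2 (2)–(3) with Prop. 4.2 («`H¹_f(K_λ, E[p^k])^±` and `H¹_s(K_λ, E[p^k])^±`
free of rank one over `ℤ/p^k`», `H¹_f = H¹_ur` at good `λ ∤ p`), used in the proof of Lemma 5.2 (i),
in the tree's `conjActPlace` currency.

References (locators only; no cited FACT is declared): [cite: Jetchev2008, §3.2 (2)–(3) (p. 815),
Prop. 4.2, Lemma 5.2 (i) (p. 822)] [cite: GrossLMS1991, §3 (3.2)–(3.4), §4] [cite: MilneADT2006,
Ch. I, Cor. 2.3, Lemma 2.9] [cite: NeukirchANT1999, Ch. II §9 Prop. (9.6)]. Design: no definitions;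
`K : Type`. Axioms: `propext`, `Classical.choice`, `Quot.sound`.
-/

set_option autoImplicit false

noncomputable section

open scoped Classical Pointwise NumberField Valued
open WeierstrassCurve Field Function NumberField IsDedekindDomain ValuativeRel
open Literature.NumberTheory.EllipticCurves Literature.NumberTheory.GaloisRepresentations
open Literature.NumberTheory.GaloisRepresentations.IsNonarchimedeanLocalField
open Literature.NumberTheory.GaloisCohomology Literature.NumberTheory.Automorphic
open Literature.AnabelianGeometry.AbsoluteAnabelian

namespace Summit.BirchSwinnertonDyer.Rank1Residual.JET.GlobalDuality

section KolyvaginLocalTerm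

variable (W : WeierstrassCurve ℚ) (K : Type) [Field K] [NumberField K] [W.IsElliptic] [W.IsGloballyMinimal]

omit [W.IsElliptic] [W.IsGloballyMinimal] in
/-- **A ring automorphism `Φ` of `\bar K_w` preserving the absolute integers (both ways) preserves the
spectral open unit ball** on the image of `\bar ℤ_K`: that ball is the maximal ideal of the absolute
integers (`mem_radical_map_maximalIdeal_iff`), preserved by `Φ` ([AbsAnab] `map_mem_absMaximalIdeal`).
[cite: SerreLocalFields1979, Ch. II §2 Prop. 3] -/
theorem spectralNorm_map_absClosureEmbedding_lt_one (w : HeightOneSpectrum (𝓞 K))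
    (Φ : AlgebraicClosure (w.adicCompletion K) ≃+* AlgebraicClosure (w.adicCompletion K))
    (hΦ : ∀ y ∈ absIntegers (valuation (w.adicCompletion K)).integer (w.adicCompletion K),
      Φ y ∈ absIntegers (valuation (w.adicCompletion K)).integer (w.adicCompletion K))
    (hΦ' : ∀ y ∈ absIntegers (valuation (w.adicCompletion K)).integer (w.adicCompletion K),
      Φ.symm y ∈ absIntegers (valuation (w.adicCompletion K)).integer (w.adicCompletion K))
    (s : absIntegers (𝓞 K) K)
    (hs : spectralNorm (w.adicCompletion K) (AlgebraicClosure (w.adicCompletion K))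
      (absClosureEmbedding K (w.adicCompletion K) s) < 1) :
    spectralNorm (w.adicCompletion K) (AlgebraicClosure (w.adicCompletion K))
      (Φ (absClosureEmbedding K (w.adicCompletion K) s)) < 1 := by
  have hw : ∀ x : w.adicCompletion K, valuation (w.adicCompletion K) x ≤ 1 ↔ ‖x‖ ≤ 1 :=
    adicCompletion_valuation_le_one_iff K w
  have hO' : ∀ r : 𝓞 K, valuation (w.adicCompletion K) (algebraMap (𝓞 K) (w.adicCompletion K) r) ≤ 1 :=
    fun r => (hw _).mpr (norm_algebraMap_ringOfIntegers_le_one K w r)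
  have hmem := absClosureEmbedding_mem_absIntegers_integer K (w.adicCompletion K)
    (valuation (w.adicCompletion K)) hO' s
  have h1 := (mem_radical_map_maximalIdeal_iff hw ⟨_, hmem⟩).mpr hs
  have h2 := map_mem_absMaximalIdeal hΦ hΦ' _ h1
  have h3 := (mem_radical_map_maximalIdeal_iff hw _).mp h2
  exact h3

omit [W.IsElliptic] [W.IsGloballyMinimal] in
/-- **`𝔓₀ ∩ \bar ℤ` is carried into itself by every `g ∈ Γ_ℚ` whose transport to `K̄` extends, along
`ι₀ : K̄ → \bar K_w`, to an integer-preserving automorphism `Φ` of `\bar K_w`** (`𝔓₀ = {s : |ι₀ s| < 1}`).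
[cite: NeukirchANT1999, Ch. II §9 Prop. (9.6)] -/
theorem smul_mem_comap_adicCompletionPrime (w : HeightOneSpectrum (𝓞 K)) (g : absoluteGaloisGroup ℚ)
    (Φ : AlgebraicClosure (w.adicCompletion K) ≃+* AlgebraicClosure (w.adicCompletion K))
    (hΦ : ∀ y ∈ absIntegers (valuation (w.adicCompletion K)).integer (w.adicCompletion K),
      Φ y ∈ absIntegers (valuation (w.adicCompletion K)).integer (w.adicCompletion K))
    (hΦ' : ∀ y ∈ absIntegers (valuation (w.adicCompletion K)).integer (w.adicCompletion K),
      Φ.symm y ∈ absIntegers (valuation (w.adicCompletion K)).integer (w.adicCompletion K))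
    (hgΦ : ∀ y : AlgebraicClosure K, absClosureEmbedding K (w.adicCompletion K)
        (absGaloisTransport (K := ℚ) (L := K) g y) = Φ (absClosureEmbedding K (w.adicCompletion K) y))
    {x : absIntegers (𝓞 ℚ) ℚ} (hx : x ∈ (adicCompletionPrime K w).comap (absIntegersMap ℚ K)) :
    g • x ∈ (adicCompletionPrime K w).comap (absIntegersMap ℚ K) := by
  rw [Ideal.mem_comap, mem_adicCompletionPrime_iff, coe_absIntegersMap] at hx ⊢
  rw [integralClosure.coe_smul, ← absGaloisTransport_absClosureEmbedding, hgΦ]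
  have hx' := spectralNorm_map_absClosureEmbedding_lt_one K w Φ hΦ hΦ' (absIntegersMap ℚ K x)
    (by rwa [coe_absIntegersMap])
  rwa [coe_absIntegersMap] at hx'

omit [W.IsElliptic] [W.IsGloballyMinimal] in
/-- **The adapted lift `liftAutPlace σ hfix` stabilises the prime `𝔓₀ ∩ \bar ℤ`**, `𝔓₀ =
adicCompletionPrime K w`: it is the transport `e γ e⁻¹` of some `γ ∈ Γ_ℚ` lying in the
decomposition group of `𝔓₀ ∩ \bar ℤ`. The lift `Θ` of the Galois transport of `K_w` (to which
`liftAutPlace` is adapted: `Θ ∘ ι₀ = ι₀ ∘ τ̃`) and its inverse preserve the absolute integers of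
`\bar K_w` (brick E₂), hence `𝔓₀`. [cite: NeukirchANT1999, Ch. II §9 Prop. (9.6)]
[cite: SerreLocalFields1979, Ch. II §2 Prop. 3] -/
theorem exists_transport_liftAutPlace_mem_decompositionSubgroup (σ : K ≃ₐ[ℚ] K)
    {w : HeightOneSpectrum (𝓞 K)} (hfix : σ • w = w) :
    ∃ γ : absoluteGaloisGroup ℚ, (∀ x, liftAutPlace σ hfix x = absGaloisTransport (K := ℚ) (L := K) γ x) ∧
      γ ∈ ((adicCompletionPrime K w).comap (absIntegersMap ℚ K)).decompositionSubgroup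
        (absoluteGaloisGroup ℚ) := by
  have hτ := isLiftOfAut_liftAutPlace σ hfix
  have hΘ := isLiftOfRingEquiv_ringEquivLift (galAdicCompletionEquiv (L := K) σ hfix)
  have hc := liftsCommute_liftAutPlace σ hfix
  obtain ⟨γ, hγ⟩ := (absGaloisTransport (K := ℚ) (L := K)).surjective hτ.algEquiv
  have hγx : ∀ x, liftAutPlace σ hfix x = absGaloisTransport (K := ℚ) (L := K) γ x := fun x => by
    rw [hγ, IsLiftOfAut.algEquiv_apply]
  have hγx' : ∀ y, absGaloisTransport (K := ℚ) (L := K) γ⁻¹ y = (liftAutPlace σ hfix).symm y := fun y => by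
    rw [map_inv, hγ, AlgEquiv.aut_inv]
    rfl
  refine ⟨γ, hγx, ?_⟩
  obtain ⟨hS, hS'⟩ := map_mem_absIntegers_of_isLiftOfRingEquiv K σ hfix hΘ
  have hfwd : ∀ x, x ∈ (adicCompletionPrime K w).comap (absIntegersMap ℚ K) →
      γ • x ∈ (adicCompletionPrime K w).comap (absIntegersMap ℚ K) := fun x hx =>
    smul_mem_comap_adicCompletionPrime K w γ _ hS hS' (fun y => by rw [← hγx, hc]) hx
  have hbwd : ∀ x, x ∈ (adicCompletionPrime K w).comap (absIntegersMap ℚ K) →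
      γ⁻¹ • x ∈ (adicCompletionPrime K w).comap (absIntegersMap ℚ K) := fun x hx =>
    smul_mem_comap_adicCompletionPrime K w γ⁻¹ _ hS' (fun y hy => by
      rw [RingEquiv.symm_symm]; exact hS y hy) (fun y => by rw [hγx', hc.symm_apply]) hx
  rw [Ideal.mem_decompositionSubgroup_iff]
  ext x
  rw [Ideal.mem_pointwise_smul_iff_inv_smul_mem]
  refine ⟨fun h => ?_, fun h => hbwd x h⟩
  have h2 := hfwd _ h
  rwa [smul_inv_smul] at h2

/-- **`#(Kum_λ ∩ ker(σ_{*,λ} − s)) = p^k` — the Kolyvagin-prime local term, UNCONDITIONALLY.**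
`K` imaginary quadratic, `τ ≠ 1`, `p` odd, `1 ≤ k ≤ M(ℓ)` for a Zhang–Kolyvagin prime `ℓ`, `v ∋ ℓ`
with `τ • v = v`, `s = ±1`: the `s`-eigenspace of `conjActPlace W τ (p^k) hfix` on the local Kummer
condition `Kum_v ≤ H¹(K_v, E[p^k])` has exactly `p^k` elements. `Kum_v = H¹_ur` (good reduction at
`v ∤ p`); `H¹_ur ≅ E[p^k]` with `σ_{*,v}` acting as the adapted lift `τ̃_*` (brick E₂); `τ̃_*` is a
balanced involution (brick D, via `exists_transport_liftAutPlace_mem_decompositionSubgroup`).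
Jetchev 2008 §3.2 (2) / Prop. 4.2: `H¹_f(K_λ, E[p^k])^± ≅ ℤ/p^k`. [cite: Jetchev2008, §3.2 (2)
(p. 815), Prop. 4.2] [cite: GrossLMS1991, §3 (3.2)–(3.4)] -/
theorem natCard_kummer_inf_ker_conjActPlace_eq_pow (hK : IsImaginaryQuadratic K) {p : ℕ}
    [Fact p.Prime] (hp2 : p ≠ 2) {k ℓ : ℕ} (hk1 : 1 ≤ k)
    (hℓ : Zhang2014.IsKolyvaginPrime (W.conductorNorm ℤ) W K p ℓ)
    (hk : k ≤ Zhang2014.kolyvaginIndex W p ℓ)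
    (v : HeightOneSpectrum (𝓞 K)) (hv : (ℓ : 𝓞 K) ∈ v.asIdeal)
    {τ : K ≃ₐ[ℚ] K} (hτ1 : τ ≠ 1) (hfix : τ • v = v) {s : ℤ} (hs : s = 1 ∨ s = -1) :
    Nat.card ↥((W.baseChange K).kummerSelmerStructure ((p ^ k : ℕ) : ℤ) (Sum.inr v) ⊓
      (conjActPlace W τ ((p ^ k : ℕ) : ℤ) hfix - s • AddMonoidHom.id _).ker) = p ^ k := by
  obtain ⟨hgood, hpv⟩ := hasGoodReductionAt_of_zhangKolyvaginPrime W K hℓ v hv 1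
  have hpv' : ((p : ℕ) : 𝓞 K) ∉ v.asIdeal := by rwa [pow_one, Int.cast_natCast] at hpv
  have hKum := X11b.KummerPT.kummerSelmerStructure_inr_eq_unramifiedSubgroup (W.baseChange K) p k hpv' hgood
  have hE := natCard_unramified_inf_ker_conjActPlace_eq W K hK hℓ hk v hv τ hfix s
  obtain ⟨γ, hγ, hγD⟩ := exists_transport_liftAutPlace_mem_decompositionSubgroup K τ hfix
  have hD := natCard_ker_torsionMap_sub_smul_eq_pow W K hK hp2 hk1 hℓ hk v hv
    (adicCompletionPrime_mem_primesAbove K v) hτ1 (isLiftOfAut_liftAutPlace τ hfix) hγ hγD hs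
  have hKum' : ((W.baseChange K).kummerSelmerStructure ((p ^ k : ℕ) : ℤ) (Sum.inr v) ⊓
        (conjActPlace W τ ((p ^ k : ℕ) : ℤ) hfix - s • AddMonoidHom.id _).ker) =
      (DiscreteGaloisModule.unramifiedSubgroup
          (GaloisRep.toLocal v ((W.baseChange K).torsionGaloisModule ((p ^ k : ℕ) : ℤ))) 1 ⊓
        (conjActPlace W τ ((p ^ k : ℕ) : ℤ) hfix - s • AddMonoidHom.id _).ker) := by
    rw [hKum]
    rfl
  have h1 := congrArg (fun A : AddSubgroup (galoisCohomology
      (((W.baseChange K).torsionGaloisModule ((p ^ k : ℕ) : ℤ)).toLocal (Sum.inr v : Place K)) 1) =>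
    Nat.card ↥A) hKum'
  exact h1.trans (hE.trans hD)

/-- **The binder `hloc` of `JET.tamagawaExponent_le_mInfty_of_localInputs`, DISCHARGED** (given the
named Poitou–Tate fact `hPT` that theorem already assumes): for `K` imaginary quadratic, `τ ≠ 1`,
`τ² = 1`, `p` odd, `k ≥ 1`, and every Zhang–Kolyvagin prime `ℓ` with `k ≤ M(ℓ)`, every place `v ∋ ℓ`,
every `hfix : τ • v = v` and `s = ±1`:
`(Kum_v).relIndex (ker(conjActPlace W τ (p^k) hfix − s)) = p^k`.
Session g5's `relIndex_kummer_ker_eq_natCard_kummer_inf` (signed local Tate duality with the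
perfect, conjugation-compatible family from `hPT`, and the lift-equivariant Weil datum
`exists_weilPairing_liftEquivariant`) turns the relative index into the count
`natCard_kummer_inf_ker_conjActPlace_eq_pow`. Jetchev 2008, proof of Lemma 5.2 (i): «`H¹_f^±` and
`H¹_s^±` are free of rank one over `ℤ/p^k`». (The hypothesis `ℓ ∉ c.primeFactors` of the binder is
not needed.) [cite: Jetchev2008, §3.2 (2)–(3), Prop. 4.2, Lemma 5.2 (i) (p. 822)]
[cite: MilneADT2006, Ch. I, Cor. 2.3] -/
theorem relIndex_kummer_ker_conjActPlace_eq_pow (hK : IsImaginaryQuadratic K)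
    (hPT : poitouTate_selmerStructure_duality_conj K) {p : ℕ} [Fact p.Prime] (hp2 : p ≠ 2)
    {τ : K ≃ₐ[ℚ] K} (hτ1 : τ ≠ 1) (hτ2 : τ * τ = 1) {k : ℕ} (hk1 : 1 ≤ k)
    [Finite (geomTorsion (W.baseChange K) ((p ^ k : ℕ) : ℤ))]
    (ℓ : ℕ) (hℓ : Zhang2014.IsKolyvaginPrime (W.conductorNorm ℤ) W K p ℓ)
    (hk : k ≤ Zhang2014.kolyvaginIndex W p ℓ)
    (v : HeightOneSpectrum (𝓞 K)) (hv : (ℓ : 𝓞 K) ∈ v.asIdeal) (hfix : τ • v = v)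
    (s : ℤ) (hs : s = 1 ∨ s = -1) :
    ((W.baseChange K).kummerSelmerStructure ((p ^ k : ℕ) : ℤ) (Sum.inr v)).relIndex
      ((conjActPlace W τ ((p ^ k : ℕ) : ℤ) hfix - s • AddMonoidHom.id _).ker) = p ^ k := by
  have hp : p.Prime := Fact.out
  haveI : NeZero (p ^ k) := ⟨pow_ne_zero k hp.ne_zero⟩
  -- the perfect, conjugation-compatible local Tate pairing (named fact) and the Weil datum (proved)
  obtain ⟨inv, hperf, -, -, -, hconj⟩ := hPT (p ^ k)
  have h2 : 2 ≤ p ^ k := le_trans hp.two_le (Nat.le_self_pow (by omega) p)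
  obtain ⟨e, hμ, hadd₁, hadd₂, halt, hnd, hgal, hτe⟩ := exists_weilPairing_liftEquivariant W K (p ^ k) h2
  have hodd : Odd (p ^ k) := (hp.odd_of_ne_two hp2).pow
  have hpp : IsPrimePow (p ^ k) := ⟨p, k, hp.prime, by omega, rfl⟩
  have hM : ∀ P : geomTorsion (W.baseChange K) ((p ^ k : ℕ) : ℤ), (p ^ k) • P = 0 := fun P =>
    Subtype.ext (by
      rw [AddSubgroup.coe_nsmul, AddSubgroup.coe_zero, ← natCast_zsmul]
      exact (mem_geomTorsion_iff _ _ _).mp P.2)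
  rw [relIndex_kummer_ker_eq_natCard_kummer_inf W τ (p ^ k) e hμ hadd₁ hadd₂ hgal halt hnd hτ2 hodd
    hpp hM inv hperf (hconj τ) hfix (hτe τ _ (isLiftOfAut_liftAutPlace τ hfix)) hs]
  exact natCard_kummer_inf_ker_conjActPlace_eq_pow W K hK hp2 hk1 hℓ hk v hv hτ1 hfix hs

end KolyvaginLocalTerm

end Summit.BirchSwinnertonDyer.Rank1Residual.JET.GlobalDuality

end
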